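import Summits.BirchSwinnertonDyer.BirchSwinnertonDyer.Theorems.ByReductionTypeAtTwoFineSelmerConjAAtTwoAdditivePotGoodClassNumberOneCriterionFrac
import Summits.BirchSwinnertonDyer.BirchSwinnertonDyer.Theorems.ByReductionTypeAtTwoFineSelmerConjAAtTwoAdditivePotGoodCensusDoorStampsA
import HarnessLib

/-!
# Route `ByReductionTypeAtTwo` (rung K4), crux C1″ `FineSelmerConjAAtTwoAdditivePotGood` (item stmt-BirchSwinnertonDyer-22615):
# CLASS NUMBER ONE FOR THE CUBIC FIELD OF DISCRIMINANT `−9388` (`X³ + (0)X² + (16)X + (-28)`, index `2`) BY A NORM CERTIFICATE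
# (KERNEL) — the `2`-torsion point field `ℚ(P)` of the census row `234700f1`, whose census stamp thereby needs NO displayed datum any more ((A)₂ modulo Lim 2017 Thm. 3.5 ALONE)
# (a `--supports 22615` file; seat `bsd-2adic-k4-w1` GEN 6; consumer of `…ClassNumberOneCriterion` / `…ClassNumberOneCriterionFrac`)

HONEST FRAMING (cell `bsd-2adic`, D-0036/D-0054): §1 UNCONDITIONAL kernel arithmetic; §2 conditional on `hLim2` (Lim 2017 Thm. 3.5 at `2`) BY NAME
and NOTHING ELSE; closes nothing at the `∀`-level; nothing booked; BSD is not proved by any of this.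

THE CERTIFICATE (generated by the seat's exact-arithmetic tools — reduced model, integral basis, relation sieve with Dedekind–Kummer
bookkeeping, unit reduction — and CHECKED HERE by the kernel): `g = X³ + (0)X² + (16)X + (-28)`, `disc g = 37552 = 2² · (-9388)`;
the integral element `ω` of the proof shows `2 ∣ [𝓞 K : ℤ[θ]]`, so `|d_K| ≤ 9388` (`sq_mul_abs_discr_le_abs_cubic_discr`) and `M_K < 28`.
For every prime `ℓ < 28` and every root `a` of `g mod ℓ` the proof lists a generator `(x + yθ + zθ²)/m` of the ideals `I ∋ ℓ, θ − a` of norm `ℓ`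
(10 witnesses, 6 of them outside `ℤ[θ]`; the prime 2 dividing the index is certified through a second generator of `𝓞 K` (`exists_intElem_of_scaled_cubic`)). No Dedekind–Kummer theory is invoked in the proof: the criterion only uses `𝓞/I ≅ 𝔽_ℓ`.

References: [Marcus1977] Ch. 2 Exercise 27, Ch. 5 Thm. 35–37; [Cohen1993] §4.8.2, §6.3; [Lim2017FineSelmer] Thm. 3.5, Lemma 3.2;
[Greenberg2001IwasawaPastPresent] Prop. 2.1 (Iwasawa 1956); [Fukuda1994] Thm. 1 (1).
-/

set_option autoImplicit false
-- sibling precedent (`…ClassNumberOneCriterionFrac.lean`): the directory name repeats the summit name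
set_option linter.dupNamespace false

noncomputable section

open scoped Classical IntermediateField NumberField Real nonZeroDivisors

namespace Summit.BirchSwinnertonDyer.BirchSwinnertonDyer.Theorems.AddKatoTwo

open WeierstrassCurve Field Polynomial IsDedekindDomain NumberField Matrix Literature.NumberTheory.EllipticCurves
  Literature.NumberTheory.GaloisRepresentations
  Literature.NumberTheory.IwasawaTheory
  Summit.BirchSwinnertonDyer.BirchSwinnertonDyer.Theorems.AlignedTransportAtTwoTorsionPointField
  Summit.BirchSwinnertonDyer.BirchSwinnertonDyer.Theses.ByReductionTypeAtTwo

/-! ## §1 The certificate: `h = 1` for the field of `X³ + (0)X² + (16)X + (-28)` -/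

section Certificate

variable (K : Type) [Field K] [NumberField K]

/-- `X³ + (0)X² + (16)X + (-28)` is irreducible over `ℚ` (no root mod `19`). -/
theorem irreducible_cubic_d9388n : Irreducible (Cubic.toPoly ⟨1, ((0 : ℤ) : ℚ), ((16 : ℤ) : ℚ), ((-28 : ℤ) : ℚ)⟩) :=
  haveI : Fact (Nat.Prime 19) := ⟨by norm_num⟩
  irreducible_cubic_of_no_root_zmod 19 (by decide)

/-- `X³ + (-1)X² + (-47)X + (153)` is irreducible over `ℚ` (no root mod `19`). -/
theorem irreducible_cubic_d9388n_aux2 : Irreducible (Cubic.toPoly ⟨1, ((-1 : ℤ) : ℚ), ((-47 : ℤ) : ℚ), ((153 : ℤ) : ℚ)⟩) :=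
  haveI : Fact (Nat.Prime 19) := ⟨by norm_num⟩
  irreducible_cubic_of_no_root_zmod 19 (by decide)

/-- **`h = 1` for every cubic number field whose integers contain a root `θ` of `X³ + (0)X² + (16)X + (-28)`** (`|disc| = 37552`, index
`2`, `M_K < 28`): a norm certificate — for every prime `ℓ < 28` and every root `a` of the cubic mod `ℓ` a generator
`(x + yθ + zθ²)/m ∈ 𝓞 K` of every ideal `I ∋ ℓ, θ − a` of norm `ℓ` (listed in the proof; `m > 1` = element of `𝓞 K ∖ ℤ[θ]`, certified by its
scaled cubic identity); the primes dividing the index (2) are certified through a second generator of `𝓞 K`. KERNEL.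
[cite: Marcus1977, Ch. 5 Thm. 37 and Cor. 2] [cite: Cohen1993, §6.3] -/
theorem classNumber_eq_one_of_root_d9388n (h3 : Module.finrank ℚ K = 3) (b : 𝓞 K)
    (hb : b ^ 3 + (0 : ℤ) * b ^ 2 + (16 : ℤ) * b + (-28 : ℤ) = 0) : NumberField.classNumber K = 1 := by
  have hirr := irreducible_cubic_d9388n
  -- `ω = (0 + 0θ + 1θ²)/2 ∈ 𝓞 K` witnesses `2 ∣ [𝓞 K : ℤ[θ]]`, so `2² · |d_K| ≤ |disc| = 37552`
  obtain ⟨ω, hω, -⟩ := exists_intElem_of_scaled_cubic K b 0 0 1 (m := 2) (by norm_num) 16 64 (-98)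
    (by push_cast; linear_combination ((28 : 𝓞 K) + (16 : 𝓞 K) * b + (1 : 𝓞 K) * b ^ 3) * hb)
  have hd : |NumberField.discr K| ≤ (9388 : ℕ) :=
    abs_discr_le_of_sq_mul_le K (k := 2) (by norm_num)
      (sq_mul_abs_discr_le_abs_cubic_discr K h3 b hirr hb (by norm_num) 0 0 1 ⟨ω, hω⟩ (by norm_num))
      (by simp only [Cubic.discr]; norm_num)
  -- second generator `b2 = (-10 + -2θ + -1θ²)/2`, a root of `X³ + (-1)X² + (-47)X + (153)` (index 3, prime to 2)
  obtain ⟨b2, -, hb2⟩ := exists_intElem_of_scaled_cubic K b (-10) (-2) (-1) (m := 2) (by norm_num) (-1) (-47) 153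
    (by push_cast; linear_combination ((-68 : 𝓞 K) + (-28 : 𝓞 K) * b + (-6 : 𝓞 K) * b ^ 2 + (-1 : 𝓞 K) * b ^ 3) * hb)
  have hirr2 := irreducible_cubic_d9388n_aux2
  refine classNumber_eq_one_of_prime_norm_principal K h3 (B := 28)
    (minkowskiBound_lt_of_sqrt_le K h3 hd (s := 96.90)
      ((Real.sqrt_le_sqrt (by norm_num : ((9388 : ℕ) : ℝ) ≤ (96.90 : ℝ) ^ 2)).trans (Real.sqrt_sq (by norm_num)).le)
      (by norm_num)) ?_
  intro ℓ hℓB hℓ J hJ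
  interval_cases ℓ <;> norm_num at hℓ
  · -- `ℓ = 2`: roots [1] (second generator `b2`)
    refine isPrincipal_of_absNorm_eq_prime_frac K h3 b2 hirr2 hb2 (by norm_num) (fun a ha hdvd => ?_) hJ
    interval_cases a <;> norm_num at hdvd
    · exact ⟨222, (-25), (-7), 3, by norm_num, by norm_num,
        (exists_intElem_of_scaled_cubic K b2 222 (-25) (-7) (m := 3) (by norm_num) 8 828 2
          (by push_cast; linear_combination ((90054 : 𝓞 K) + (546 : 𝓞 K) * b2 + (-4018 : 𝓞 K) * b2 ^ 2 + (-343 : 𝓞 K) * b2 ^ 3) * hb2)).imp (fun _ h => h.1), by norm_num⟩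
  · -- `ℓ = 3`: roots [2]
    refine isPrincipal_of_absNorm_eq_prime_frac K h3 b hirr hb (by norm_num) (fun a ha hdvd => ?_) hJ
    interval_cases a <;> norm_num at hdvd
    · exact ⟨2, (-12), 7, 2, by norm_num, by norm_num,
        (exists_intElem_of_scaled_cubic K b 2 (-12) 7 (m := 2) (by norm_num) 109 5255 (-3)
          (by push_cast; linear_combination ((-1532 : 𝓞 K) + (8512 : 𝓞 K) * b + (-1764 : 𝓞 K) * b ^ 2 + (343 : 𝓞 K) * b ^ 3) * hb)).imp (fun _ h => h.1), by norm_num⟩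
  · -- `ℓ = 5`: roots [4]
    refine isPrincipal_of_absNorm_eq_prime K h3 b hirr hb (by norm_num) (fun a ha hdvd => ?_) hJ
    interval_cases a <;> norm_num at hdvd
    · exact ⟨(-3), 2, 0, by norm_num, by norm_num⟩
  · -- `ℓ = 7`: roots [0]
    refine isPrincipal_of_absNorm_eq_prime K h3 b hirr hb (by norm_num) (fun a ha hdvd => ?_) hJ
    interval_cases a <;> norm_num at hdvd
    · exact ⟨(-7), 0, 3, by norm_num, by norm_num⟩
  · -- `ℓ = 11`: roots [1]
    refine isPrincipal_of_absNorm_eq_prime K h3 b hirr hb (by norm_num) (fun a ha hdvd => ?_) hJ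
    interval_cases a <;> norm_num at hdvd
    · exact ⟨(-1), 1, 0, by norm_num, by norm_num⟩
  · -- `ℓ = 13`: roots [9]
    refine isPrincipal_of_absNorm_eq_prime_frac K h3 b hirr hb (by norm_num) (fun a ha hdvd => ?_) hJ
    interval_cases a <;> norm_num at hdvd
    · exact ⟨(-18), (-2), (-1), 2, by norm_num, by norm_num,
        (exists_intElem_of_scaled_cubic K b (-18) (-2) (-1) (m := 2) (by norm_num) 11 (-7) 13
          (by push_cast; linear_combination ((-68 : 𝓞 K) + (-28 : 𝓞 K) * b + (-6 : 𝓞 K) * b ^ 2 + (-1 : 𝓞 K) * b ^ 3) * hb)).imp (fun _ h => h.1), by norm_num⟩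
  · -- `ℓ = 17`: roots [8, 11, 15]
    refine isPrincipal_of_absNorm_eq_prime_frac K h3 b hirr hb (by norm_num) (fun a ha hdvd => ?_) hJ
    interval_cases a <;> norm_num at hdvd
    · exact ⟨93, (-67), 4, 1, by norm_num, by norm_num, ⟨_, by rw [Nat.cast_one, one_mul]⟩, by norm_num⟩
    · exact ⟨(-2), 0, 1, 2, by norm_num, by norm_num,
        (exists_intElem_of_scaled_cubic K b (-2) 0 1 (m := 2) (by norm_num) 19 99 (-17)
          (by push_cast; linear_combination ((28 : 𝓞 K) + (16 : 𝓞 K) * b + (1 : 𝓞 K) * b ^ 3) * hb)).imp (fun _ h => h.1), by norm_num⟩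
    · exact ⟨(-30), 12, 5, 2, by norm_num, by norm_num,
        (exists_intElem_of_scaled_cubic K b (-30) 12 5 (m := 2) (by norm_num) 125 3991 17
          (by push_cast; linear_combination ((10028 : 𝓞 K) + (4160 : 𝓞 K) * b + (900 : 𝓞 K) * b ^ 2 + (125 : 𝓞 K) * b ^ 3) * hb)).imp (fun _ h => h.1), by norm_num⟩
  · -- `ℓ = 19`: roots none
    refine isPrincipal_of_absNorm_eq_prime K h3 b hirr hb (by norm_num) (fun a ha hdvd => ?_) hJ
    interval_cases a <;> norm_num at hdvd
  · -- `ℓ = 23`: roots [16]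
    refine isPrincipal_of_absNorm_eq_prime_frac K h3 b hirr hb (by norm_num) (fun a ha hdvd => ?_) hJ
    interval_cases a <;> norm_num at hdvd
    · exact ⟨10, (-8), 1, 2, by norm_num, by norm_num,
        (exists_intElem_of_scaled_cubic K b 10 (-8) 1 (m := 2) (by norm_num) 1 403 (-23)
          (by push_cast; linear_combination ((-612 : 𝓞 K) + (208 : 𝓞 K) * b + (-24 : 𝓞 K) * b ^ 2 + (1 : 𝓞 K) * b ^ 3) * hb)).imp (fun _ h => h.1), by norm_num⟩

end Certificate

/-! ## §2 The census row `234700f1` -/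

/-- **(A)₂ for the census curve `234700f1` modulo Lim 2017 Thm. 3.5 ALONE — NO displayed datum.** Its `2`-torsion cubic field
(`d = -9388`) has `h = 1` BY THE KERNEL (`classNumber_eq_one_of_root_d9388n`): the element
`θ = 8498669839653/1616029490375 + (-105980633/1616029490375)·β + (-1378/1616029490375)·β²` of `ℚ(β)` (`β` a root of the `2`-division cubic) is a root of `X³ + (0)X² + (16)X + (-28)` and
`β = -73493 + (-16635)·θ + (-6890)·θ²`, so `ℚ(P) = ℚ(β) = ℚ(θ)` (identities = `linear_combination`s of the `2`-division relation; coefficients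
found by exact linear algebra in `ℚ[X]/(G)`). UPGRADES `conjA_two_234700f1_of_oddClassNumber`. [cite: Lim2017FineSelmer, §3 Thm. 3.5 and Lemma 3.2]
[cite: Greenberg2001IwasawaPastPresent, Prop. 2.1 p. 339] [cite: Cohen1993, §6.3] -/
theorem conjA_two_234700f1
    (hLim2 : Lim2017.thm35_at_two_fineSelmerDual_moduleFinite_of_classicalMuVanishes_of_le_divisionField_four)
    (κ : ZpExtension ℚ 2) (hκ : κ.IsCyclotomic) :
    haveI := isElliptic_234700f1'
    ∃ (γ : absoluteGaloisGroup ℚ) (D : (⟨0, ((-1 : ℤ) : ℚ), 0, ((-9251053533 : ℤ) : ℚ), ((456179572918937 : ℤ) : ℚ)⟩ : WeierstrassCurve ℚ).FineSelmerDualData κ γ),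
      Module.Finite ℤ_[2] (RestrictScalars ℤ_[2] (IwasawaAlgebra 2) D.X) := by
  haveI := isElliptic_234700f1'
  obtain ⟨β, hβ⟩ : ∃ β : AlgebraicClosure ℚ, aeval β (Cubic.toPoly ⟨1, ((-1 : ℤ) : ℚ), ((-9251053533 : ℤ) : ℚ), ((456179572918937 : ℤ) : ℚ)⟩) = 0 :=
    IsAlgClosed.exists_aeval_eq_zero _ _ (by rw [Cubic.degree_of_a_ne_zero one_ne_zero]; norm_num)
  have hβ' : β ^ 3 + (-1 : AlgebraicClosure ℚ) * β ^ 2 + (-9251053533 : AlgebraicClosure ℚ) * β + (456179572918937 : AlgebraicClosure ℚ) = 0 := by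
    have := hβ
    simp only [Cubic.toPoly, map_one, one_mul, aeval_add, aeval_mul, aeval_C, aeval_X_pow, aeval_X,
      eq_ratCast, Rat.cast_intCast] at this
    push_cast at this
    linear_combination this
  set θ : AlgebraicClosure ℚ := algebraMap ℚ (AlgebraicClosure ℚ) (8498669839653 / 1616029490375 : ℚ) +
      algebraMap ℚ (AlgebraicClosure ℚ) (-105980633 / 1616029490375 : ℚ) * β + algebraMap ℚ (AlgebraicClosure ℚ) (-1378 / 1616029490375 : ℚ) * β ^ 2 with hθdef
  have hθ : aeval θ (Cubic.toPoly ⟨1, ((0 : ℤ) : ℚ), ((16 : ℤ) : ℚ), ((-28 : ℤ) : ℚ)⟩) = 0 := by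
    simp only [Cubic.toPoly, map_one, one_mul, aeval_add, aeval_mul, aeval_C, aeval_X_pow, aeval_X, eq_ratCast,
      Rat.cast_intCast]
    rw [hθdef]
    simp only [eq_ratCast]
    push_cast
    linear_combination (((1865016654062994730936721 : AlgebraicClosure ℚ) / 4220343938666453038376479053646484375) + ((-22226173000777212454 : AlgebraicClosure ℚ) / 4220343938666453038376479053646484375) * β + ((-603737401602868 : AlgebraicClosure ℚ) / 4220343938666453038376479053646484375) * β ^ 2 + ((-2616662152 : AlgebraicClosure ℚ) / 4220343938666453038376479053646484375) * β ^ 3) * hβ'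
  have hadj : IntermediateField.adjoin ℚ {θ} = IntermediateField.adjoin ℚ {β} := by
    apply le_antisymm
    · rw [IntermediateField.adjoin_simple_le_iff, hθdef]
      have hβmem := IntermediateField.mem_adjoin_simple_self ℚ β
      exact add_mem (add_mem (algebraMap_mem _ _) (mul_mem (algebraMap_mem _ _) hβmem))
        (mul_mem (algebraMap_mem _ _) (pow_mem hβmem 2))
    · rw [IntermediateField.adjoin_simple_le_iff]
      have hβeq : β = algebraMap ℚ (AlgebraicClosure ℚ) (-73493 : ℚ) + algebraMap ℚ (AlgebraicClosure ℚ) (-16635 : ℚ) * θ +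
          algebraMap ℚ (AlgebraicClosure ℚ) (-6890 : ℚ) * θ ^ 2 := by
        rw [hθdef]; simp only [eq_ratCast]; push_cast; linear_combination (((402492473289296 : AlgebraicClosure ℚ) / 522310262752336443528125) + ((2616662152 : AlgebraicClosure ℚ) / 522310262752336443528125) * β) * hβ'
      rw [hβeq]
      have hθmem := IntermediateField.mem_adjoin_simple_self ℚ θ
      exact add_mem (add_mem (algebraMap_mem _ _) (mul_mem (algebraMap_mem _ _) hθmem))
        (mul_mem (algebraMap_mem _ _) (pow_mem hθmem 2))
  refine conjA_two_234700f1_of_oddClassNumber hLim2 hβ ?_ κ hκ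
  rw [← hadj]
  exact not_two_dvd_card_classGroup_adjoin_of_forall_cubicField irreducible_cubic_d9388n (classNumber_eq_one_of_root_d9388n) hθ

end Summit.BirchSwinnertonDyer.BirchSwinnertonDyer.Theorems.AddKatoTwo

end
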